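import Literature.AnabelianGeometry.SemiGraphs.OncePuncturedTemperedGroupPadicWitness
import Mathlib.NumberTheory.Padics.RingHoms
import Mathlib.FieldTheory.Galois.Infinite
import HarnessLib

/-!
# [EtTh] §1 p. 238 — kernel tools for the cyclotomic identifications `Δ_Θ ≅ Ẑ(1)`,
# `1 → Ẑ(1) → Δ^ell_X → Ẑ → 1`, `(Δ^tp_Y)^ell ≅ Ẑ(1)`: a `ℚ_p`-inhabitant of
# `OncePuncturedTemperedGroup` whose `Π^tp_X`-action on `Δ_X` is INNER, and a root of unity moved by `G_{ℚ₃}`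

Mochizuki, *The étale theta function and its Frobenioid-theoretic manifestations*, Publ. RIMS **45**
(2009) [EtTh], §1, PRIMS p. 238 [cite: MochizukiEtTh2009, §1 p.238]: "we have a natural exact sequence
`1 → Ẑ(1) → Δ^ell_X → Ẑ → 1` … `(Ẑ(1) ≅) Δ_Θ ⊆ Δ^Θ_X` … Thus, `(Δ^tp_Y)^ell ≅ Ẑ(1)`" — statements about
`Ẑ(1) = lim_n μ_n(K̄)` as a `G_K`-MODULE, typed in `TemperedCyclotomic.lean` (abc-iut-L3) as the named
predicates `DeltaThetaIsoTate Ω`, `DeltaEllExtension Ω`, `DeltaYEllIsoTate Ω`, `DeltaYEllClosureIsoTate Ω`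
on the origin hypothesis `Ω : TemperedPiOrigin K` (FACT-LIST rows F-0658, F-0657, F-0659, F-1697 of the
abc-iut cell).

PROOF-ONLY file (abc-iut cell, block C / W6 seat abc-iut-w6-d060; no definition, no instance, no named
fact). It supplies the two kernel ingredients used by `TemperedCyclotomicClosures.lean` to decide the
universal closures of those four predicates:

* `OncePuncturedTemperedGroup.exists_model_padic_inner` — over `K = ℚ_p`, an inhabitant `D` of the L3
  interface `OncePuncturedTemperedGroup ℚ_p` (the PRODUCT model `Π := (F̂₂ ×_Ẑ ℤ) × G_{ℚ_p}` of
  `OncePuncturedTemperedGroupPadicWitness.lean`, abc-iut-w5-d218, re-assembled verbatim) TOGETHER WITH the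
  kernel-visible form of that file's honest label "`G_K` acts trivially on `Δ`": for every `g ∈ Π^tp_X`
  the conjugation action of `ĝ ∈ Π_X` on `Δ_X = F̂₂ × 1` coincides with conjugation by an element of `Δ_X`
  itself (namely `(pr₁ g, 1)`). Consistency evidence for the axiom package only — NOT `π₁^temp` of a curve.
* `padic_three_sq_ne_neg_one`, `exists_gal_moves_fourth_root_padic_three` — `−1` is not a square in `ℚ₃`
  (a square root would be a `3`-adic unit whose reduction squares to `−1` in `𝔽₃`), hence by the infinite
  Galois correspondence (Mathlib `InfiniteGalois.mem_range_algebraMap_iff_fixed`, `Q̄₃/ℚ₃` Galois) some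
  `σ ∈ G_{ℚ₃}` moves a primitive fourth root of unity `i ∈ Q̄₃` [cite: Serre1973, Ch. II §3.3 Thm. 3].

HONEST FRAMING: nothing of [EtTh]/[SemiAnbd] is asserted; the model is degenerate by design (split
extension, trivial outer action); no side is taken on [IUTchIII] Cor. 3.12; typed ≠ proved.
-/

noncomputable section

open Topology TopologicalSpace Filter Set Function CategoryTheory
open Literature.IUT.HodgeTheaters (profiniteCompletion toCompletion toCompletion_int_injective)
open Literature.AlgebraicGeometry.Frobenioids (IsSlimGroup)

universe u v

namespace Literature.AnabelianGeometry.SemiGraphs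

/-! ### The product model over `ℚ_p`, with its inner conjugation action on `Δ_X` -/

/-- **A `ℚ_p`-inhabitant of `OncePuncturedTemperedGroup` on whose `Δ_X` every element of `Π^tp_X` acts
by an INNER automorphism of `Δ_X`.** The product model `Π := Γ × G_{ℚ_p}`, `Γ = F̂₂ ×_Ẑ ℤ`,
`Π̂ := F̂₂ × G_{ℚ_p}`, `toHat := pr₁ × id`, `Δ_X = F̂₂ × 1` of `OncePuncturedTemperedGroupPadicWitness.lean`
(abc-iut-w5-d218; the construction is repeated here verbatim because that file exposes only `Nonempty`),
with the additional output: for `g = (γ, σ)`, conjugation by `ĝ = (pr₁ γ, σ)` on `Δ_X = F̂₂ × 1` equals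
conjugation by `(pr₁ γ, 1) ∈ Δ_X`. This is the kernel form of that file's honest label "the extension
`1 → Δ → Π → G_K → 1` splits and `G_K` acts trivially on `Δ`" — so the model cannot carry the
`G_K`-module structure `Ẑ(1)` of [EtTh] §1 p. 238 on any subquotient of `Δ_X` on which inner
automorphisms act trivially (see `TemperedCyclotomicClosures.lean`). Consistency evidence for the axiom
package only; not the tempered fundamental group of a curve. [cite: MochizukiEtTh2009, §1 pp.237-239] -/
theorem OncePuncturedTemperedGroup.exists_model_padic_inner (p : ℕ) [Fact p.Prime] :
    ∃ D : OncePuncturedTemperedGroup ℚ_[p], ∀ g : D.Pi, ∃ d : D.deltaHat,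
      ∀ h : D.deltaHat, D.toHat g * (h : D.PiHat) * (D.toHat g)⁻¹ = d * h * (d : D.PiHat)⁻¹ := by
  classical
  -- ##### the geometric part `Γ = F̂₂ ×_Ẑ ℤ` (as in `OncePuncturedTemperedGroupWitness`)
  let P : ProfiniteGrp.{0} := profiniteCompletion (FreeGroup (Fin 2))
  let Zh : ProfiniteGrp.{0} := profiniteCompletion (Multiplicative ℤ)
  let η : FreeGroup (Fin 2) →* P := toCompletion (FreeGroup (Fin 2))
  let ι : Multiplicative ℤ →* Zh := toCompletion (Multiplicative ℤ)
  let a : FreeGroup (Fin 2) := FreeGroup.of 0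
  let b : FreeGroup (Fin 2) := FreeGroup.of 1
  let σa : FreeGroup (Fin 2) →* Multiplicative ℤ :=
    FreeGroup.lift fun j => if j = (0 : Fin 2) then Multiplicative.ofAdd (1 : ℤ) else 1
  let σb : FreeGroup (Fin 2) →* Multiplicative ℤ :=
    FreeGroup.lift fun j => if j = (1 : Fin 2) then Multiplicative.ofAdd (1 : ℤ) else 1
  have hσaa : σa a = Multiplicative.ofAdd 1 := by simp [σa, a]
  have hσab : σa b = 1 := by simp [σa, b]
  have hσba : σb a = 1 := by simp [σb, a]
  have hσbb : σb b = Multiplicative.ofAdd 1 := by simp [σb, b]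
  let e : P →ₜ* Zh := (ProfiniteGrp.ProfiniteCompletion.lift (GrpCat.ofHom (ι.comp σa))).hom
  let êb : P →ₜ* Zh := (ProfiniteGrp.ProfiniteCompletion.lift (GrpCat.ofHom (ι.comp σb))).hom
  let îa : Zh →ₜ* P :=
    (ProfiniteGrp.ProfiniteCompletion.lift (GrpCat.ofHom (η.comp (zpowersHom _ a)))).hom
  let îb : Zh →ₜ* P :=
    (ProfiniteGrp.ProfiniteCompletion.lift (GrpCat.ofHom (η.comp (zpowersHom _ b)))).hom
  have he : ∀ g, e (η g) = ι (σa g) := fun g => lift_hom_toCompletion Zh (ι.comp σa) g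
  have hêb : ∀ g, êb (η g) = ι (σb g) := fun g => lift_hom_toCompletion Zh (ι.comp σb) g
  have hîa : ∀ k : ℤ, îa (ι (Multiplicative.ofAdd k)) = η (a ^ k) := fun k => by
    rw [lift_hom_toCompletion P (η.comp (zpowersHom _ a))]; simp [zpowersHom_apply]
  have hîb : ∀ k : ℤ, îb (ι (Multiplicative.ofAdd k)) = η (b ^ k) := fun k => by
    rw [lift_hom_toCompletion P (η.comp (zpowersHom _ b))]; simp [zpowersHom_apply]
  have hιinj : Injective ι := toCompletion_int_injective
  let Γ : Subgroup (P × Multiplicative ℤ) :=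
    (e.toMonoidHom.comp (MonoidHom.fst P (Multiplicative ℤ))).eqLocus
      (ι.comp (MonoidHom.snd P (Multiplicative ℤ)))
  have hΓ : ∀ q : P × Multiplicative ℤ, q ∈ Γ ↔ e q.1 = ι q.2 := fun q => Iff.rfl
  have hηd : DenseRange η := ProfiniteGrp.ProfiniteCompletion.denseRange (GrpCat.of (FreeGroup (Fin 2)))
  have hηN : ∀ N : Subgroup (FreeGroup (Fin 2)), N.Normal → N.FiniteIndex →
      ∃ V : OpenNormalSubgroup P, ∀ g, η g ∈ V ↔ g ∈ N :=
    fun N _ _ => exists_openNormal_eta_mem_iff N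
  have hs : Surjective σa := fun n => ⟨a ^ n.toAdd, by
    rw [map_zpow, hσaa, ← ofAdd_zsmul, smul_eq_mul, mul_one]; rfl⟩
  have hZ : ∀ A : Subgroup (Multiplicative ℤ), A.FiniteIndex →
      ∀ k : Multiplicative ℤ, ι k ∈ closure (ι '' (A : Set (Multiplicative ℤ))) → k ∈ A :=
    fun A hA k hk => by haveI := hA; exact mem_of_toCompletion_mem_closure A k hk
  haveI hscP : SecondCountableTopology P := secondCountableTopology_profiniteCompletion_freeGroup (Fin 2)
  have hTΓ : IsTempered Γ := TemperedFibreProduct.isTempered e ι Γ hΓ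
  have hSlimΓ : IsSlimGroup Γ :=
    TemperedFibreProduct.isSlimGroup e êb îa îb σa σb hσaa hσab hσba hσbb he hêb hîa hîb hιinj Γ hΓ
  haveI : SecondCountableTopology Γ := TemperedFibreProduct.secondCountableTopology Γ
  let zQuotΓ : Γ →* Multiplicative ℤ := (MonoidHom.snd P (Multiplicative ℤ)).comp Γ.subtype
  let prΓ : Γ →ₜ* P := ⟨(MonoidHom.fst P (Multiplicative ℤ)).comp Γ.subtype,
    continuous_fst.comp continuous_subtype_val⟩
  have hPC : IsProfiniteCompletion prΓ :=
    TemperedFibreProduct.isProfiniteCompletion_fst e ι Γ hΓ η hηd hηN σa hs he hZ prΓ fun _ => rfl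
  -- ##### the arithmetic part `G = G_{ℚ_p}`
  haveI : IsGalois ℚ_[p] (AlgebraicClosure ℚ_[p]) := {}
  haveI : CompactSpace (Field.absoluteGaloisGroup ℚ_[p]) := by
    change CompactSpace (AlgebraicClosure ℚ_[p] ≃ₐ[ℚ_[p]] AlgebraicClosure ℚ_[p]); infer_instance
  haveI : T2Space (Field.absoluteGaloisGroup ℚ_[p]) := krullTopology_t2
  haveI : TotallyDisconnectedSpace (Field.absoluteGaloisGroup ℚ_[p]) := by
    change TotallyDisconnectedSpace (AlgebraicClosure ℚ_[p] ≃ₐ[ℚ_[p]] AlgebraicClosure ℚ_[p])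
    infer_instance
  -- `G_{ℚ_p}` is Galois-countable (second countable): countably many open subgroups (tree, Krasner) and
  -- the cosets of the open normal subgroups form a basis (re-derived inline; cf. the companion
  -- `TemperedArithmeticGroupPadicWitness.secondCountableTopology_absoluteGaloisGroup_padic`)
  haveI : SecondCountableTopology (Field.absoluteGaloisGroup ℚ_[p]) := by
    haveI := Literature.NumberTheory.GaloisRepresentations.Padic.isValuativeTopology p
    haveI : IsNonarchimedeanLocalField ℚ_[p] := {}
    haveI : Countable (OpenSubgroup (Field.absoluteGaloisGroup ℚ_[p])) :=
      Literature.NumberTheory.GaloisRepresentations.countable_openSubgroup_of_isNonarchimedeanLocalField ℚ_[p]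
    let B : Set (Set (Field.absoluteGaloisGroup ℚ_[p])) :=
      ⋃ U : OpenSubgroup (Field.absoluteGaloisGroup ℚ_[p]),
        Set.range fun q : Field.absoluteGaloisGroup ℚ_[p] ⧸ U.toSubgroup =>
          (QuotientGroup.mk ⁻¹' {q} : Set (Field.absoluteGaloisGroup ℚ_[p]))
    have hBc : B.Countable := by
      refine Set.countable_iUnion fun U => ?_
      haveI : Finite (Field.absoluteGaloisGroup ℚ_[p] ⧸ U.toSubgroup) := inferInstance
      exact (Set.finite_range _).countable
    have hBopen : ∀ s ∈ B, IsOpen s := by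
      intro s hs
      obtain ⟨U, hU⟩ := Set.mem_iUnion.mp hs
      obtain ⟨q, rfl⟩ := hU
      exact (isOpen_discrete {q}).preimage (QuotientGroup.continuous_mk (N := U.toSubgroup))
    have hB : IsTopologicalBasis B := by
      refine isTopologicalBasis_of_isOpen_of_nhds hBopen ?_
      intro x O hxO hO
      have hO' : IsOpen ((fun y : Field.absoluteGaloisGroup ℚ_[p] => x * y) ⁻¹' O) :=
        hO.preimage (continuous_const.mul continuous_id)
      obtain ⟨V, hV⟩ :=
        ProfiniteGrp.exist_openNormalSubgroup_sub_open_nhds_of_one hO' (by simpa using hxO)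
      refine ⟨QuotientGroup.mk ⁻¹' {(QuotientGroup.mk x : Field.absoluteGaloisGroup ℚ_[p] ⧸ V.toSubgroup)},
        ?_, rfl, ?_⟩
      · exact Set.mem_iUnion.mpr ⟨V.toOpenSubgroup, ⟨_, rfl⟩⟩
      · intro y hy
        have hy' : (QuotientGroup.mk y : Field.absoluteGaloisGroup ℚ_[p] ⧸ V.toSubgroup) =
            QuotientGroup.mk x := hy
        have hxy : x⁻¹ * y ∈ V.toSubgroup := QuotientGroup.eq.mp hy'.symm
        have := hV hxy
        simpa using this
    exact hB.secondCountableTopology hBc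
  have hSlimG : IsSlimGroup (Field.absoluteGaloisGroup ℚ_[p]) :=
    Literature.AnabelianGeometry.AbsoluteAnabelian.galoisMLF_slim_holds p ℚ_[p]
  -- ##### the product `Π := Γ × G`
  let aug : (Γ × Field.absoluteGaloisGroup ℚ_[p]) →ₜ* Field.absoluteGaloisGroup ℚ_[p] :=
    ContinuousMonoidHom.snd _ _
  have haug_mem : ∀ x : Γ × Field.absoluteGaloisGroup ℚ_[p], x ∈ aug.toMonoidHom.ker ↔ x.2 = 1 :=
    fun x => MonoidHom.mem_ker
  have hkerClosed : IsClosed (aug.toMonoidHom.ker : Set (Γ × Field.absoluteGaloisGroup ℚ_[p])) := by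
    rw [MonoidHom.coe_ker]; exact isClosed_singleton.preimage (map_continuous aug)
  -- `Ker aug = Γ × 1 ≃ₜ* Γ`
  let eKer : Γ ≃ₜ* aug.toMonoidHom.ker :=
    { toFun := fun γ => ⟨(γ, 1), (haug_mem _).mpr rfl⟩
      invFun := fun x => x.1.1
      left_inv := fun _ => rfl
      right_inv := fun x => by
        obtain ⟨⟨γ, g⟩, hx⟩ := x
        have hg : g = 1 := (haug_mem _).mp hx
        subst hg; rfl
      map_mul' := fun _ _ => rfl
      continuous_toFun := (continuous_id.prodMk continuous_const).subtype_mk _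
      continuous_invFun := continuous_fst.comp continuous_subtype_val }
  have hT : IsTempered (Γ × Field.absoluteGaloisGroup ℚ_[p]) := hTΓ.prod_of_profinite
  -- `toHat := prΓ × id`
  let toHat : (Γ × Field.absoluteGaloisGroup ℚ_[p]) →ₜ* (P × Field.absoluteGaloisGroup ℚ_[p]) :=
    prΓ.prodMap (ContinuousMonoidHom.id _)
  have htoHat : ∀ x : Γ × Field.absoluteGaloisGroup ℚ_[p],
      toHat x = ((x.1 : P × Multiplicative ℤ).1, x.2) := fun _ => rfl
  have hPC' : IsProfiniteCompletion toHat := hPC.prodMap_id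
  let augHat : (P × Field.absoluteGaloisGroup ℚ_[p]) →ₜ* Field.absoluteGaloisGroup ℚ_[p] :=
    ContinuousMonoidHom.snd _ _
  -- `Ker augHat = P × 1 = closure of toHat(Ker aug)`
  have hmemP1 : ∀ y : P, ((y, (1 : Field.absoluteGaloisGroup ℚ_[p])) : P × _) ∈
      ((aug.toMonoidHom.ker).map toHat.toMonoidHom).topologicalClosure := by
    intro y
    -- `(y,1)` is in the closure of `{(pr₁ q, 1)}` since `pr₁` has dense range
    have hsub : (fun z : P => ((z, (1 : Field.absoluteGaloisGroup ℚ_[p])) : P × _)) '' Set.range prΓ ⊆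
        (((aug.toMonoidHom.ker).map toHat.toMonoidHom : Subgroup _) : Set _) := by
      rintro _ ⟨_, ⟨q, rfl⟩, rfl⟩
      exact ⟨(q, 1), (haug_mem _).mpr rfl, rfl⟩
    have hcl : ((y, (1 : Field.absoluteGaloisGroup ℚ_[p])) : P × _) ∈
        closure ((fun z : P => ((z, (1 : Field.absoluteGaloisGroup ℚ_[p])) : P × _)) '' Set.range prΓ) := by
      have hy : y ∈ closure (Set.range prΓ) := by
        rw [hPC.denseRange.closure_range]; exact Set.mem_univ _
      exact image_closure_subset_closure_image (continuous_id.prodMk continuous_const) ⟨y, hy, rfl⟩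
    exact closure_mono hsub hcl
  have hkerHat : augHat.toMonoidHom.ker = ((aug.toMonoidHom.ker).map toHat.toMonoidHom).topologicalClosure := by
    refine le_antisymm ?_ ?_
    · rintro ⟨y, g⟩ hyg
      have hg : g = 1 := hyg
      subst hg
      exact hmemP1 y
    · refine Subgroup.topologicalClosure_minimal _ ?_ ?_
      · rintro _ ⟨x, hx, rfl⟩
        have hx2 : x.2 = 1 := (haug_mem x).mp hx
        change (toHat x).2 = 1
        rw [htoHat]; exact hx2
      · rw [MonoidHom.coe_ker]; exact isClosed_singleton.preimage (map_continuous augHat)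
  -- `Δ̂ = P × 1 ≃ₜ* P = F̂₂` is profinite free on two generators
  have hfree : ∃ x : Fin 2 → ((aug.toMonoidHom.ker).map toHat.toMonoidHom).topologicalClosure,
      IsFreeProfiniteOn _ x := by
    let S := ((aug.toMonoidHom.ker).map toHat.toMonoidHom).topologicalClosure
    have hS2 : ∀ z : S, (z : P × Field.absoluteGaloisGroup ℚ_[p]).2 = 1 := fun z => by
      have hz : (z : P × _) ∈ augHat.toMonoidHom.ker := by rw [hkerHat]; exact z.2
      exact hz
    let eS : P ≃ₜ* S :=
      { toFun := fun y => ⟨(y, 1), hmemP1 y⟩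
        invFun := fun z => (z : P × Field.absoluteGaloisGroup ℚ_[p]).1
        left_inv := fun _ => rfl
        right_inv := fun z => Subtype.ext (Prod.ext rfl (hS2 z).symm)
        map_mul' := fun _ _ => rfl
        continuous_toFun := (continuous_id.prodMk continuous_const).subtype_mk _
        continuous_invFun := continuous_fst.comp continuous_subtype_val }
    exact ⟨_, (isFreeProfiniteOn_profiniteCompletion_freeGroup (Fin 2)).of_continuousMulEquiv eS⟩
  -- the cusp group `1 × G`
  let D : Subgroup (Γ × Field.absoluteGaloisGroup ℚ_[p]) := (⊥ : Subgroup Γ).prod ⊤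
  haveI hDn : D.Normal := Subgroup.prod_normal ⊥ ⊤
  -- ##### the conjugation action of `Π` on `Δ̂ = P × 1` is INNER (by `(pr₁ γ, 1) ∈ Δ̂`)
  have hinner : ∀ g : Γ × Field.absoluteGaloisGroup ℚ_[p],
      ∃ d : ((aug.toMonoidHom.ker).map toHat.toMonoidHom).topologicalClosure,
        ∀ h : ((aug.toMonoidHom.ker).map toHat.toMonoidHom).topologicalClosure,
          toHat g * (h : P × Field.absoluteGaloisGroup ℚ_[p]) * (toHat g)⁻¹ =
            d * h * (d : P × Field.absoluteGaloisGroup ℚ_[p])⁻¹ := by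
    intro g
    refine ⟨⟨(((g.1 : Γ) : P × Multiplicative ℤ).1, 1), hmemP1 _⟩, fun h => ?_⟩
    have h2 : (h : P × Field.absoluteGaloisGroup ℚ_[p]).2 = 1 := by
      have hz : (h : P × Field.absoluteGaloisGroup ℚ_[p]) ∈ augHat.toMonoidHom.ker := by
        rw [hkerHat]; exact h.2
      exact hz
    rw [htoHat]
    refine Prod.ext ?_ ?_
    · simp only [Prod.fst_mul, Prod.fst_inv]
    · simp only [Prod.snd_mul, Prod.snd_inv, h2, mul_one, mul_inv_cancel, inv_one]
  refine ⟨{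
    Pi := Γ × Field.absoluteGaloisGroup ℚ_[p]
    isTempered := hT
    aug := aug
    aug_surjective := fun g => ⟨(1, g), rfl⟩
    isTempered_ker := hT.subgroup_of_isClosed _ hkerClosed
    isSlimGroup := isSlimGroup_prod hSlimΓ hSlimG
    isSlimGroup_ker := isSlimGroup_of_continuousMulEquiv eKer hSlimΓ
    secondCountableTopology := inferInstance
    zQuot := zQuotΓ.comp (MonoidHom.fst Γ (Field.absoluteGaloisGroup ℚ_[p]))
    zQuot_surjective := (TemperedFibreProduct.snd_surjective_of e ι Γ hΓ
      (TemperedFibreProduct.exists_apply_eq_iota e ι η σa hs he)).comp Prod.fst_surjective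
    isOpen_ker_zQuot := by
      have : (((zQuotΓ.comp (MonoidHom.fst Γ (Field.absoluteGaloisGroup ℚ_[p]))).ker :
          Subgroup (Γ × _)) : Set (Γ × Field.absoluteGaloisGroup ℚ_[p])) =
          Prod.fst ⁻¹' (zQuotΓ.ker : Set Γ) := by
        ext x; simp [MonoidHom.mem_ker]
      rw [this]
      exact (TemperedFibreProduct.isOpen_ker_snd Γ).preimage continuous_fst
    PiHat := P × Field.absoluteGaloisGroup ℚ_[p]
    toHat := toHat
    isProfiniteCompletion_toHat := hPC'
    toHat_injective := (TemperedFibreProduct.fst_injective e ι Γ hΓ hιinj).prodMap injective_id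
    augHat := augHat
    augHat_comp_toHat := fun _ => rfl
    ker_augHat := hkerHat
    deltaHat_free := hfree
    cuspDecomp := {D}
    cuspDecomp_nonempty := ⟨D, rfl⟩
    isClosed_of_mem_cuspDecomp := fun D' hD' => by
      rw [Set.mem_singleton_iff.mp hD', Subgroup.coe_prod, Subgroup.coe_bot, Subgroup.coe_top]
      exact isClosed_singleton.prod isClosed_univ
    le_ker_of_mem_cuspDecomp := fun D' hD' => by
      rw [Set.mem_singleton_iff.mp hD']
      rintro ⟨γ, g⟩ hx
      have hγ : γ = 1 := (Subgroup.mem_prod.mp hx).1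
      subst hγ
      simp [MonoidHom.mem_ker]
    conj_mem_cuspDecomp := fun D' hD' x => by
      rw [Set.mem_singleton_iff.mp hD', Set.mem_singleton_iff]
      exact Subgroup.Normal.map_conj_eq D x
    map_aug_eq_top_of_mem_cuspDecomp := fun D' hD' => by
      rw [Set.mem_singleton_iff.mp hD']
      refine eq_top_iff.mpr fun g _ => ⟨(1, g), Subgroup.mem_prod.mpr ⟨Subgroup.mem_bot.mpr rfl,
        Subgroup.mem_top g⟩, rfl⟩ }, hinner⟩

/-! ### A root of unity moved by `G_{ℚ₃}` -/

/-- **`−1` is not a square in `ℚ₃`.** A square root `x` would satisfy `‖x‖² = ‖−1‖ = 1`, so `x ∈ ℤ₃`, and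
its reduction in `𝔽₃ = ℤ₃/3` would square to `−1`; but the squares of `𝔽₃` are `0, 1` (Serre's classification of
squares in `ℚ_p`, `p ≠ 2`: `p^n u` is a square iff `n` is even and `ū ∈ 𝔽_p^{×2}`). [cite: Serre1973, Ch. II §3.3 Thm. 3] -/
theorem padic_three_sq_ne_neg_one (x : ℚ_[3]) : x ^ 2 ≠ -1 := by
  intro hx
  have hnorm : ‖x‖ = 1 := by
    have h : ‖x‖ ^ 2 = 1 := by rw [← norm_pow, hx, norm_neg, norm_one]
    nlinarith [norm_nonneg x]
  let u : ℤ_[3] := ⟨x, hnorm.le⟩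
  have hu : u ^ 2 = -1 := by
    apply Subtype.ext
    push_cast
    exact hx
  have h3 : (PadicInt.toZMod u) ^ 2 = -1 := by
    rw [← map_pow, hu, map_neg, map_one]
  have : ∀ a : ZMod 3, a ^ 2 ≠ -1 := by decide
  exact this _ h3

/-- **Some `σ ∈ G_{ℚ₃} = Gal(Q̄₃/ℚ₃)` moves a (primitive) fourth root of unity.** `Q̄₃` contains `i` with
`i² = −1` (algebraically closed), `i ∉ ℚ₃` (`padic_three_sq_ne_neg_one`), and `Q̄₃/ℚ₃` is Galois
(characteristic `0`), so the fixed field of the whole Galois group is `ℚ₃` (Mathlib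
`InfiniteGalois.mem_range_algebraMap_iff_fixed`) and `i` is not fixed by every `σ`. The automorphism is
stated through the tree's `Field.absoluteGaloisGroup ℚ₃ = (Q̄₃ ≃ₐ[ℚ₃] Q̄₃)`. Classical consequence of `−1 ∉ ℚ₃^{×2}`.
[cite: Serre1973, Ch. II §3.3 Thm. 3] -/
theorem exists_gal_moves_fourth_root_padic_three :
    ∃ (σ : Field.absoluteGaloisGroup ℚ_[3]) (ζ : AlgebraicClosure ℚ_[3]), ζ ^ 4 = 1 ∧
      (show AlgebraicClosure ℚ_[3] ≃ₐ[ℚ_[3]] AlgebraicClosure ℚ_[3] from σ) ζ ≠ ζ := by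
  obtain ⟨i, hi⟩ := IsAlgClosed.exists_pow_nat_eq (-1 : AlgebraicClosure ℚ_[3]) (by norm_num : 0 < 2)
  have hi4 : i ^ 4 = 1 := by
    rw [show (4 : ℕ) = 2 * 2 from rfl, pow_mul, hi]; norm_num
  -- `i ∉ ℚ₃`
  have hnot : i ∉ Set.range (algebraMap ℚ_[3] (AlgebraicClosure ℚ_[3])) := by
    rintro ⟨x, hx⟩
    apply padic_three_sq_ne_neg_one x
    apply (algebraMap ℚ_[3] (AlgebraicClosure ℚ_[3])).injective
    rw [map_pow, hx, hi, map_neg, map_one]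
  haveI : IsGalois ℚ_[3] (AlgebraicClosure ℚ_[3]) := {}
  rw [InfiniteGalois.mem_range_algebraMap_iff_fixed] at hnot
  push Not at hnot
  obtain ⟨σ, hσ⟩ := hnot
  exact ⟨σ, i, hi4, hσ⟩

end Literature.AnabelianGeometry.SemiGraphs

end
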